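import Literature.AlgebraicGeometry.HodgeTheory.SupportedClassesSemipurity
import Literature.AlgebraicGeometry.HodgeTheory.AlgebraicClassesCup
import Literature.AlgebraicTopology.SingularHomology.CohomologyMayerVietorisExtend
import HarnessLib

/-!
# Additivity of supported classes below the purity degree: `Hⁱ(X) → Hⁱ(X ∖ Z)` is onto for `i + 1 < 2 codim Z`, and `ker (Hⁱ(X) → Hⁱ(X ∖ (Z₁ ∪ Z₂)))` is the sum of the two kernels when `codim (Z₁ ∩ Z₂) > (i + 1)/2` (proved)

Family `hodge`, layer `Literature/AlgebraicGeometry/HodgeTheory`. Companion of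
`SupportedClassesSemipurity` (Grothendieck 1969 §1; Voisin I §11.1.2: `Hⁱ(X(ℂ)) → Hⁱ((X ∖ Z)(ℂ))`
is one-to-one for `i < 2 codim Z`), which proves HALF of Voisin's Lemma 11.13 ("the restriction
map `Hˡ(X, ℤ) → Hˡ(X − Y, ℤ)` is an isomorphism for `l ≤ 2r`", `Y` of codimension `> r`) along the
straightening filtration of Thm. 11.11. This file proves the OTHER half and its first consequence
for the kernels of restriction whose sums are the coniveau carriers
`supportedClasses X i c = Nᶜ Hⁱ(X(ℂ); ℂ)` (`HodgeTheory/AlgebraicClasses`):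

* `surjective_cohomologyMap_of_injective_homologyMap` — over a field, `f_*` one-to-one on `Hₙ`
  gives `f^*` onto on `Hⁿ` (universal coefficients, Hatcher Thm. 3.2, and a splitting of `f_*`).
* `injective_map_complexPointsCompl_of_lt_coheight` / `surjective_restrictCompl_of_lt_coheight` —
  for `X` smooth projective over `ℂ` and `Z ⊆ X` Zariski-closed with every point of codimension
  `≥ c`, `Hᵢ((X ∖ Z)(ℂ)) → Hᵢ(X(ℂ))` is one-to-one and `Hⁱ(X(ℂ); ℂ) → Hⁱ((X ∖ Z)(ℂ); ℂ)` is ONTO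
  for `i + 1 < 2c` (Voisin I, Lemma 11.13 with Thm. 11.11: the same downward induction on `c` as in
  `SupportedClassesSemipurity`, fed by the one-to-one half of the tree's
  `surjective_injective_map_compl_of_locallyFlat`). Equivalently `H^{i+1}_Z(X(ℂ); ℂ) = 0`.
* `ker_restrictCompl_union_le` — **additivity**: for Zariski-closed `Z₁, Z₂ ⊆ X` whose
  intersection has codimension `≥ c` everywhere and `i + 1 < 2c`,
  `ker (Hⁱ(X) → Hⁱ(X ∖ (Z₁ ∪ Z₂))) ≤ ker (Hⁱ(X) → Hⁱ(X ∖ Z₁)) + ker (Hⁱ(X) → Hⁱ(X ∖ Z₂))`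
  (the reverse inclusion is `ker_restrictCompl_le_of_subset`). This is the Mayer–Vietoris sequence
  of cohomology WITH SUPPORTS, `Hⁱ_{Z₁}(X) ⊕ Hⁱ_{Z₂}(X) → Hⁱ_{Z₁ ∪ Z₂}(X) → H^{i+1}_{Z₁ ∩ Z₂}(X) = 0`,
  read on the tree's absolute carriers: glue `(a|_{X ∖ Z₁}, 0)` over the open cover
  `{(X ∖ Z₁)(ℂ), (X ∖ Z₂)(ℂ)}` of `(X ∖ (Z₁ ∩ Z₂))(ℂ)` (Hatcher §3.1, the tree's
  `singularCohomology.exists_of_map_inclusion_eq`) and extend the glued class to `X(ℂ)` by the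
  ontoness above. [Grothendieck 1969 §1; Bloch–Ogus 1974 (1.1.2); Voisin I §11.1.2]

Consumer: `SupportedClassesIrreducible` (`Nˡ H²ˡ` is generated by classes supported on irreducible
subvarieties; the moving hypothesis of `AlgebraicClassesCup` for irreducible supports only).
Everything is proved; no definitions, no named facts.

## References

* [GrothendieckTopology1969] A. Grothendieck, Hodge's general conjecture is false for trivial
  reasons, Topology 8 (1969), §1.
* [VoisinHodgeI2002] C. Voisin, Hodge Theory and Complex Algebraic Geometry I, CUP 2002, §11.1.1
  Thm. 11.11, §11.1.2 Lemma 11.13.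
* [HatcherAT2002] A. Hatcher, Algebraic Topology, CUP 2002, §3.1 Thm. 3.2 and pp. 203–204.
-/

noncomputable section

open CategoryTheory AlgebraicGeometry Set TopologicalSpace
open Literature.AlgebraicTopology.SingularHomology

namespace Literature.AlgebraicGeometry.HodgeTheory

section HodgeTheory

/-! ### Duality: one-to-one on homology gives onto on cohomology over a field -/

/-- Over a field, if `f_* : Hₙ(A; F) → Hₙ(B; F)` is one-to-one then `f^* : Hⁿ(B; F) → Hⁿ(A; F)`
is onto: a functional `⟨a, –⟩` on `Hₙ(A)` extends along the split injection `f_*` to `Hₙ(B)`,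
where it is `⟨b, –⟩` for some `b` (the Kronecker map `Hⁿ → Hom(Hₙ, F)` is onto over a field,
Hatcher Thm. 3.2), and `⟨f^* b, c⟩ = ⟨b, f_* c⟩ = ⟨a, c⟩` for all `c` forces `f^* b = a` (the
Kronecker map is one-to-one). [cite: HatcherAT2002, §3.1 Thm. 3.2 (p. 195) and p. 198] -/
theorem surjective_cohomologyMap_of_injective_homologyMap (F : Type) [Field F] {A B : Type}
    [TopologicalSpace A] [TopologicalSpace B] (f : C(A, B)) (n : ℕ)
    (hf : Function.Injective (singularHomology.map F F f n)) :
    Function.Surjective (singularCohomology.map F F f n) := by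
  intro a
  obtain ⟨g, hg⟩ := LinearMap.exists_leftInverse_of_injective (singularHomology.map F F f n).hom
    (LinearMap.ker_eq_bot.2 hf)
  obtain ⟨b, hb⟩ := (kroneckerPairing_bijective_of_field F B n).2
    ((kroneckerPairing F F A n a).comp g)
  refine ⟨b, kroneckerPairing_injective_of_field F A n (LinearMap.ext fun c ↦ ?_)⟩
  rw [kroneckerPairing_map, hb, LinearMap.comp_apply]
  congr 1
  exact LinearMap.congr_fun hg c

/-! ### Homological injectivity and cohomological surjectivity below `2 codim Z - 1` -/

variable {n : ℕ} {X : Motives.SchemeOver ℂ}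

/-- **`Hᵢ((X ∖ Z)(ℂ); M) → Hᵢ(X(ℂ); M)` is one-to-one for `i + 1 < 2 codim Z`** (Voisin I,
Lemma 11.13 along the filtration of Thm. 11.11; Grothendieck 1969 §1), `X` smooth projective over
`ℂ`, `Z ⊆ X` Zariski-closed with every point of codimension `≥ c`. Downward induction on `c` as in
`surjective_map_complexPointsCompl_of_le_coheight`: off a closed `Z₁ ⊆ Z` of codimension `≥ c + 1`
the set `Z(ℂ)` is locally flat of real codimension `≥ 2c` (`GAGADimension.exists_closed_straightening_off`),
so inside `(X ∖ Z₁)(ℂ)` the inclusion of `(X ∖ Z)(ℂ)` is one-to-one on `Hᵢ` for `i + 1 < 2c`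
(`surjective_injective_map_compl_of_locallyFlat`, second half), and `(X ∖ Z₁)(ℂ) → X(ℂ)` is
one-to-one on `Hᵢ` by induction.
[cite: VoisinHodgeI2002, §11.1.2 Lemma 11.13 and §11.1.1 Thm. 11.11] [cite: GrothendieckTopology1969, §1] -/
theorem injective_map_complexPointsCompl_of_lt_coheight (R : Type) [CommRing R] (M : Type)
    [AddCommGroup M] [Module R M] (hX : Motives.IsSmoothProjective n X) {Z : Set X.left}
    (hZ : IsClosed Z) {c : ℕ} (hcZ : ∀ z ∈ Z, (c : ℕ∞) ≤ Order.coheight z) {i : ℕ}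
    (hi : i + 1 < 2 * c) :
    Function.Injective (singularHomology.map R M
      (subsetIncl {P : Motives.ComplexPoints X | P.pt ∉ Z}) i) := by
  -- second countability of `X(ℂ)`
  haveI := hX.smoothOfRelativeDimension
  haveI : LocallyOfFiniteType X.hom := by
    haveI : Smooth X.hom := SmoothOfRelativeDimension.smooth n _
    infer_instance
  haveI := Motives.IsSmoothProjective.compactSpace_holds hX
  haveI : SecondCountableTopology (Motives.ComplexPoints X) :=
    Motives.ComplexPoints.secondCountableTopology_of_compactSpace_holds X
  -- downward induction on the codimension, along Voisin's filtration
  suffices key : ∀ (m c : ℕ) (Z : Set X.left), n + 1 ≤ c + m → IsClosed Z →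
      (∀ z ∈ Z, (c : ℕ∞) ≤ Order.coheight z) → ∀ i, i + 1 < 2 * c →
        Function.Injective (singularHomology.map R M
          (subsetIncl {P : Motives.ComplexPoints X | P.pt ∉ Z}) i) from
    key (n + 1) c Z (by omega) hZ hcZ i hi
  -- the empty case
  have hempty : ∀ (Z : Set X.left), Z = ∅ → ∀ i, Function.Injective (singularHomology.map R M
      (subsetIncl {P : Motives.ComplexPoints X | P.pt ∉ Z}) i) := by
    rintro Z rfl i
    have hc : ((Homeomorph.refl (Motives.ComplexPoints X) : _ ≃ₜ _) :
        C(Motives.ComplexPoints X, Motives.ComplexPoints X)).comp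
        (subsetIncl {P : Motives.ComplexPoints X | P.pt ∉ (∅ : Set X.left)}) =
        (ContinuousMap.id _).comp (((Homeomorph.setCongr (by ext P; simp)).trans
          (Homeomorph.Set.univ (Motives.ComplexPoints X)) :
            ↥{P : Motives.ComplexPoints X | P.pt ∉ (∅ : Set X.left)} ≃ₜ Motives.ComplexPoints X) :
          C(↥{P : Motives.ComplexPoints X | P.pt ∉ (∅ : Set X.left)}, Motives.ComplexPoints X)) :=
      ContinuousMap.ext fun _ ↦ rfl
    refine (injective_map_iff_of_homeomorph R M _ _ _ _ hc i).2 ?_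
    rw [singularHomology.map_id]
    exact Function.injective_id
  intro m
  induction m with
  | zero =>
    intro c Z hcm hZ hcZ i hi
    exact hempty Z (eq_empty_of_dim_lt_coheight hX (by omega) hcZ) i
  | succ m ih =>
    intro c Z hcm hZ hcZ i hi
    by_cases hcn : n + 1 ≤ c
    · exact hempty Z (eq_empty_of_dim_lt_coheight hX hcn hcZ) i
    -- the exceptional set `Z₁` and the straightening charts off it
    obtain ⟨Z₁, hZ₁, hZ₁Z, hcZ₁, hstr⟩ := GAGADimension.exists_closed_straightening_off hX hZ hcZ
    have ih₁ := ih (c + 1) Z₁ (by omega) hZ₁ hcZ₁ i (by omega)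
    -- the open subspace `X₁ = (X ∖ Z₁)(ℂ)` and its closed subset `S = Z(ℂ) ∩ X₁`
    have hO : IsOpen {P : Motives.ComplexPoints X | P.pt ∉ Z₁} :=
      Motives.AlgPoints.isOpen_setOf_pt_mem (X := X) (L := ℂ) ⟨Z₁ᶜ, hZ₁.isOpen_compl⟩
    set S : Set ↥{P : Motives.ComplexPoints X | P.pt ∉ Z₁} := {Q | Q.1.pt ∈ Z} with hSdef
    have hS : IsClosed S := by
      have h1 : IsClosed {P : Motives.ComplexPoints X | P.pt ∈ Z} :=
        ⟨Motives.AlgPoints.isOpen_setOf_pt_mem (X := X) (L := ℂ) ⟨Zᶜ, hZ.isOpen_compl⟩⟩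
      exact h1.preimage continuous_subtype_val
    -- local flatness of `S` in `X₁`
    have hflat : ∀ x ∈ S, ∃ (F : Type) (_ : NormedAddCommGroup F) (_ : NormedSpace ℝ F)
        (_ : FiniteDimensional ℝ F) (K : Type) (_ : NormedAddCommGroup K) (_ : NormedSpace ℝ K)
        (e : OpenPartialHomeomorph ↥{P : Motives.ComplexPoints X | P.pt ∉ Z₁} (F × K)),
        2 * c ≤ Module.finrank ℝ F ∧ x ∈ e.source ∧ ∀ z ∈ e.source, z ∈ S ↔ (e z).1 = 0 := by
      intro x hx
      obtain ⟨c', K, e, hcc', hxe, he⟩ := hstr x.1 hx x.2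
      let s : Opens (Motives.ComplexPoints X) := ⟨{P | P.pt ∉ Z₁}, hO⟩
      let e' : OpenPartialHomeomorph ↥{P : Motives.ComplexPoints X | P.pt ∉ Z₁} ((Fin c' → ℂ) × ↥K) :=
        e.subtypeRestr (s := s) ⟨x⟩
      refine ⟨Fin c' → ℂ, inferInstance, inferInstance, inferInstance, ↥K, inferInstance,
        inferInstance, e', ?_, ?_, fun z hz ↦ ?_⟩
      · have hfr : Module.finrank ℝ (Fin c' → ℂ) = 2 * c' := by
          rw [Module.finrank_pi_fintype, Finset.sum_const, Finset.card_univ, Fintype.card_fin,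
            Complex.finrank_real_complex, smul_eq_mul, mul_comm]
        rw [hfr]
        omega
      · rw [OpenPartialHomeomorph.subtypeRestr_source]
        exact hxe
      · rw [OpenPartialHomeomorph.subtypeRestr_source] at hz
        exact he z.1 hz
    have hinj := (surjective_injective_map_compl_of_locallyFlat R M hS (2 * c) hflat).2 i hi
    -- `Hᵢ(Sᶜ) → Hᵢ(X₁) → Hᵢ(X(ℂ))` is one-to-one, and `Sᶜ ≃ (X ∖ Z)(ℂ)` over `X(ℂ)`
    let eS : ↥Sᶜ ≃ₜ ↥{P : Motives.ComplexPoints X | P.pt ∉ Z} :=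
      { toFun := fun Q ↦ ⟨Q.1.1, Q.2⟩
        invFun := fun P ↦ ⟨⟨P.1, fun h ↦ P.2 (hZ₁Z h)⟩, P.2⟩
        left_inv := fun _ ↦ rfl
        right_inv := fun _ ↦ rfl
        continuous_toFun := by fun_prop
        continuous_invFun := by fun_prop }
    have hcomp : ((Homeomorph.refl (Motives.ComplexPoints X) : _ ≃ₜ _) :
        C(Motives.ComplexPoints X, Motives.ComplexPoints X)).comp
        ((subsetIncl {P : Motives.ComplexPoints X | P.pt ∉ Z₁}).comp (subsetIncl Sᶜ)) =
        (subsetIncl {P : Motives.ComplexPoints X | P.pt ∉ Z}).comp (eS : C(↥Sᶜ, _)) :=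
      ContinuousMap.ext fun _ ↦ rfl
    refine (injective_map_iff_of_homeomorph R M eS (Homeomorph.refl _) _ _ hcomp i).1 ?_
    rw [singularHomology.map_comp]
    intro x y hxy
    rw [ModuleCat.comp_apply, ModuleCat.comp_apply] at hxy
    exact hinj (ih₁ hxy)

/-- **The restriction `Hⁱ(X(ℂ); ℂ) → Hⁱ((X ∖ Z)(ℂ); ℂ)` is ONTO for `i + 1 < 2 codim Z`** (the
second half of Voisin I, Lemma 11.13 — "`Hˡ(X) → Hˡ(X − Y)` is an isomorphism for `l ≤ 2r`",
`codim Y > r` — along Thm. 11.11; equivalently `H^{i+1}_Z(X(ℂ)) = 0`), `X` smooth projective over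
`ℂ`, `Z` Zariski-closed with every point of codimension `≥ c`: dual to
`injective_map_complexPointsCompl_of_lt_coheight` under the Kronecker pairing over `ℂ`.
[cite: VoisinHodgeI2002, §11.1.2 Lemma 11.13 and §11.1.1 Thm. 11.11] [cite: GrothendieckTopology1969, §1] -/
theorem surjective_restrictCompl_of_lt_coheight (hX : Motives.IsSmoothProjective n X)
    {Z : Set X.left} (hZ : IsClosed Z) {c : ℕ} (hcZ : ∀ z ∈ Z, (c : ℕ∞) ≤ Order.coheight z)
    {i : ℕ} (hi : i + 1 < 2 * c) : Function.Surjective (complexBetti.restrictCompl X Z i) :=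
  surjective_cohomologyMap_of_injective_homologyMap ℂ
    (subsetIncl {P : Motives.ComplexPoints X | P.pt ∉ Z}) i
    (injective_map_complexPointsCompl_of_lt_coheight ℂ ℂ hX hZ hcZ hi)

/-! ### Additivity of the kernels of restriction -/

/-- **Additivity of supports below the purity degree** (Mayer–Vietoris with supports:
`Hⁱ_{Z₁}(X) ⊕ Hⁱ_{Z₂}(X) → Hⁱ_{Z₁ ∪ Z₂}(X) → H^{i+1}_{Z₁ ∩ Z₂}(X)`, and
`H^{i+1}_{Z₁ ∩ Z₂}(X(ℂ)) = 0` for `i + 1 < 2 codim (Z₁ ∩ Z₂)`; Grothendieck 1969 §1, Bloch–Ogus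
(1.1.2)). For `X` smooth projective over `ℂ`, Zariski-closed `Z₁, Z₂ ⊆ X` with every point of
`Z₁ ∩ Z₂` of codimension `≥ c`, and `i + 1 < 2c`: a class `a ∈ Hⁱ(X(ℂ); ℂ)` vanishing on
`(X ∖ (Z₁ ∪ Z₂))(ℂ)` is `a₁ + a₂` with `a₁` vanishing on `(X ∖ Z₁)(ℂ)` and `a₂` on `(X ∖ Z₂)(ℂ)`.
Proof on the absolute carriers: glue `a|` on `(X ∖ Z₁)(ℂ)` with `0` on `(X ∖ Z₂)(ℂ)` — an open
cover of `(X ∖ (Z₁ ∩ Z₂))(ℂ)` on whose overlap `(X ∖ (Z₁ ∪ Z₂))(ℂ)` both vanish — to a class `e`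
(`singularCohomology.exists_of_map_inclusion_eq`, Hatcher §3.1), extend `e = a₂|` to `X(ℂ)`
(`surjective_restrictCompl_of_lt_coheight`), and put `a₁ = a − a₂`.
[cite: GrothendieckTopology1969, §1] [cite: HatcherAT2002, §3.1 pp. 203–204]
[cite: VoisinHodgeI2002, §11.1.2 Lemma 11.13] -/
theorem ker_restrictCompl_union_le (hX : Motives.IsSmoothProjective n X) {Z₁ Z₂ : Set X.left}
    (hZ₁ : IsClosed Z₁) (hZ₂ : IsClosed Z₂) {c : ℕ}
    (hc : ∀ t ∈ Z₁ ∩ Z₂, (c : ℕ∞) ≤ Order.coheight t) {i : ℕ} (hi : i + 1 < 2 * c) :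
    LinearMap.ker (complexBetti.restrictCompl X (Z₁ ∪ Z₂) i).hom ≤
      LinearMap.ker (complexBetti.restrictCompl X Z₁ i).hom ⊔
        LinearMap.ker (complexBetti.restrictCompl X Z₂ i).hom := by
  intro a ha
  have ha' : complexBetti.restrictCompl X (Z₁ ∪ Z₂) i a = 0 := ha
  -- the ambient open subspace `W = (X ∖ (Z₁ ∩ Z₂))(ℂ)` and its open cover `{A, B}`
  set A : Set (Motives.complexPointsCompl X (Z₁ ∩ Z₂)) := {Q | Q.1.pt ∉ Z₁} with hAdef
  set B : Set (Motives.complexPointsCompl X (Z₁ ∩ Z₂)) := {Q | Q.1.pt ∉ Z₂} with hBdef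
  have hA : IsOpen A := (isOpen_setOf_pt_not_mem hZ₁).preimage continuous_subtype_val
  have hB : IsOpen B := (isOpen_setOf_pt_not_mem hZ₂).preimage continuous_subtype_val
  have hAB : A ∪ B = univ := by
    refine Set.eq_univ_of_forall fun Q ↦ ?_
    by_cases h : Q.1.pt ∈ Z₁
    · exact Or.inr fun h' ↦ Q.2 ⟨h, h'⟩
    · exact Or.inl h
  -- the class `a|` on `A` and `0` on `B` agree on `A ∩ B ⊆ (X ∖ (Z₁ ∪ Z₂))(ℂ)`
  let aW : singularCohomology ℂ ℂ (Motives.complexPointsCompl X (Z₁ ∩ Z₂)) i :=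
    complexBetti.restrictCompl X (Z₁ ∩ Z₂) i a
  let aA : singularCohomology ℂ ℂ ↥A i := singularCohomology.map ℂ ℂ (subsetIncl A) i aW
  let k : C(↥(A ∩ B), Motives.complexPointsCompl X (Z₁ ∪ Z₂)) :=
    ⟨fun Q ↦ ⟨Q.1.1, fun h ↦ h.elim Q.2.1 Q.2.2⟩, by fun_prop⟩
  have hk : ((⟨Subtype.val, continuous_subtype_val⟩ :
      C(Motives.complexPointsCompl X (Z₁ ∩ Z₂), Motives.ComplexPoints X)).comp (subsetIncl A)).comp
        (ContinuousMap.inclusion (inter_subset_left : A ∩ B ⊆ A)) =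
      (⟨Subtype.val, continuous_subtype_val⟩ :
        C(Motives.complexPointsCompl X (Z₁ ∪ Z₂), Motives.ComplexPoints X)).comp k :=
    ContinuousMap.ext fun _ ↦ rfl
  have hagree : singularCohomology.map ℂ ℂ
      (ContinuousMap.inclusion (inter_subset_left : A ∩ B ⊆ A)) i aA =
      singularCohomology.map ℂ ℂ (ContinuousMap.inclusion (inter_subset_right : A ∩ B ⊆ B)) i 0 := by
    rw [map_zero]
    change ((complexBetti.restrictCompl X (Z₁ ∩ Z₂) i ≫ singularCohomology.map ℂ ℂ (subsetIncl A) i) ≫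
      singularCohomology.map ℂ ℂ (ContinuousMap.inclusion (inter_subset_left : A ∩ B ⊆ A)) i) a = 0
    rw [complexBetti.restrictCompl, ← singularCohomology.map_comp, ← singularCohomology.map_comp, hk,
      singularCohomology.map_comp, ModuleCat.comp_apply]
    change singularCohomology.map ℂ ℂ k i (complexBetti.restrictCompl X (Z₁ ∪ Z₂) i a) = 0
    rw [ha', map_zero]
  -- glue, then extend to `X(ℂ)`
  obtain ⟨e, heA, heB⟩ := singularCohomology.exists_of_map_inclusion_eq ℂ hA hB hAB aA 0 hagree
  obtain ⟨a₂, ha₂⟩ := surjective_restrictCompl_of_lt_coheight hX (hZ₁.inter hZ₂) hc hi e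
  -- `a₂` dies off `Z₂`, `a - a₂` dies off `Z₁`
  have hfac₂ : (⟨Subtype.val, continuous_subtype_val⟩ :
      C(Motives.complexPointsCompl X Z₂, Motives.ComplexPoints X)) =
      (⟨Subtype.val, continuous_subtype_val⟩ :
        C(Motives.complexPointsCompl X (Z₁ ∩ Z₂), Motives.ComplexPoints X)).comp
        ((subsetIncl B).comp (⟨fun P ↦ ⟨⟨P.1, fun h ↦ P.2 h.2⟩, P.2⟩, by fun_prop⟩ :
          C(Motives.complexPointsCompl X Z₂, ↥B))) :=
    ContinuousMap.ext fun _ ↦ rfl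
  have hfac₁ : (⟨Subtype.val, continuous_subtype_val⟩ :
      C(Motives.complexPointsCompl X Z₁, Motives.ComplexPoints X)) =
      (⟨Subtype.val, continuous_subtype_val⟩ :
        C(Motives.complexPointsCompl X (Z₁ ∩ Z₂), Motives.ComplexPoints X)).comp
        ((subsetIncl A).comp (⟨fun P ↦ ⟨⟨P.1, fun h ↦ P.2 h.1⟩, P.2⟩, by fun_prop⟩ :
          C(Motives.complexPointsCompl X Z₁, ↥A))) :=
    ContinuousMap.ext fun _ ↦ rfl
  have h₂ : complexBetti.restrictCompl X Z₂ i a₂ = 0 := by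
    rw [complexBetti.restrictCompl, hfac₂, singularCohomology.map_comp, singularCohomology.map_comp,
      ModuleCat.comp_apply, ModuleCat.comp_apply]
    change singularCohomology.map ℂ ℂ _ i (singularCohomology.map ℂ ℂ (subsetIncl B) i
      (complexBetti.restrictCompl X (Z₁ ∩ Z₂) i a₂)) = 0
    rw [ha₂, heB, map_zero]
  have h₁ : complexBetti.restrictCompl X Z₁ i (a - a₂) = 0 := by
    rw [complexBetti.restrictCompl, hfac₁, singularCohomology.map_comp, singularCohomology.map_comp,
      ModuleCat.comp_apply, ModuleCat.comp_apply]
    change singularCohomology.map ℂ ℂ _ i (singularCohomology.map ℂ ℂ (subsetIncl A) i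
      (complexBetti.restrictCompl X (Z₁ ∩ Z₂) i (a - a₂))) = 0
    rw [map_sub, map_sub, ha₂, heA, sub_self, map_zero]
  exact Submodule.mem_sup.2 ⟨a - a₂, h₁, a₂, h₂, sub_add_cancel a a₂⟩

/-- Trivial converse: a class dying off `Z` dies off any larger `Z' ⊇ Z` (restriction to the smaller
open set factors through the larger one). [cite: GrothendieckTopology1969, §1] -/
theorem ker_restrictCompl_le_of_subset {Z Z' : Set X.left} (h : Z ⊆ Z') (i : ℕ) :
    LinearMap.ker (complexBetti.restrictCompl X Z i).hom ≤
      LinearMap.ker (complexBetti.restrictCompl X Z' i).hom := by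
  intro a ha
  have ha' : complexBetti.restrictCompl X Z i a = 0 := ha
  have hfac : (⟨Subtype.val, continuous_subtype_val⟩ :
      C(Motives.complexPointsCompl X Z', Motives.ComplexPoints X)) =
      (⟨Subtype.val, continuous_subtype_val⟩ :
        C(Motives.complexPointsCompl X Z, Motives.ComplexPoints X)).comp
        (⟨fun P ↦ ⟨P.1, fun h' ↦ P.2 (h h')⟩, by fun_prop⟩ :
          C(Motives.complexPointsCompl X Z', Motives.complexPointsCompl X Z)) :=
    ContinuousMap.ext fun _ ↦ rfl
  change complexBetti.restrictCompl X Z' i a = 0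
  rw [complexBetti.restrictCompl, hfac, singularCohomology.map_comp, ModuleCat.comp_apply]
  change singularCohomology.map ℂ ℂ _ i (complexBetti.restrictCompl X Z i a) = 0
  rw [ha', map_zero]

end HodgeTheory

end Literature.AlgebraicGeometry.HodgeTheory

end
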